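import Summits.Langlands.Langlands.Theses.LiftDescend
import Summits.Langlands.Langlands.Theses.CMFern
import HarnessLib

/-!
# `QuasiCharKernelOpen` (stmt-Langlands-10478; routes LiftDescend, CMFern) — proved BY NAME

Quasi-characters of `Fˣ` for a non-archimedean local field `F` have open kernel
(Bushnell–Henniart 2006, §1.1/§1.5): DISCHARGED in the tree as
`Literature.NumberTheory.Automorphic.isOpen_ker_quasiChar_holds` (LocalLanglandsGLProofs.lean).
The item only restates that fact with the instance binders in the order
`[Field F] [TopologicalSpace F] [ValuativeRel F]`; the one-line proof below was attached as a
candidate by grounders on 2026-08-15 and never landed.  Both route copies of the decl are proved.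
-/

namespace Summit.Langlands.Langlands.Theorems

set_option linter.dupNamespace false in
/-- **stmt-Langlands-10478** `LiftDescend.QuasiCharKernelOpen` (Bushnell–Henniart 2006 §1.5;
tree `isOpen_ker_quasiChar_holds`). -/
theorem liftDescend_quasiCharKernelOpen_proof :
    Summit.Langlands.Langlands.Theses.LiftDescend.QuasiCharKernelOpen :=
  fun F _ _ _ _ => Literature.NumberTheory.Automorphic.isOpen_ker_quasiChar_holds (F := F)

set_option linter.dupNamespace false in
/-- **stmt-Langlands-10478** `CMFern.QuasiCharKernelOpen` (same statement, CMFern's copy). -/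
theorem cmFern_quasiCharKernelOpen_proof :
    Summit.Langlands.Langlands.Theses.CMFern.QuasiCharKernelOpen :=
  fun F _ _ _ _ => Literature.NumberTheory.Automorphic.isOpen_ker_quasiChar_holds (F := F)

end Summit.Langlands.Langlands.Theorems
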